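import Literature.NumberTheory.Automorphic.SLTwoTreeQuadraticTorusShellCountUnramified   -- ★ p846991 (this seat): inert shells, `(q−1)·#Fix + 2 = (q+1)qⁿ` for a unit of the inert order
import HarnessLib

/-!
# Fixed vertices of an UNRAMIFIED-ELLIPTIC element of `GL₂(F)` on the tree of `SL₂(F)`: conjugation to the torus form `a·(1 + eτ)`, `τ² = ε₀`, and the vertex-ball count
# `(q − 1)·#Fix(g) + 2 = (q + 1)·qⁿ`, `|e| = |ϖ|ⁿ` (Labesse–Langlands 1979 §2 p. 8; Serre, *Trees* II.1.1; Kottwitz 1988 §2)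

Topic `NumberTheory/Automorphic`; namespace `Literature.NumberTheory.Automorphic.HermitianLatticeTree` (ROAD W's).  KERNEL mathematics only: theorems, no definition, no
named fact, no instance, no notation, no `sorry`.  Cell `pub/hodgecm-mathlib` (D-0151), crux H413 = `stmt-HodgeConjecture-24833`; «S3-ram» seeding wave (LEAD F0P3a-plan (g12)
T11-62; owner F0P3a-p06 (g15)); seat A-p12 (g23).  Organ «TYPE-(2) DESCENT TO TORUS FORM», `GL₂(F)` half: the bridge between the DESCENDED element `g ∈ GL₂(L⁺_v)` of a
type-(2) `γ_H` at a tame-RAMIFIED place (★ (W1) `exists_conj_diagonal_eq_smul_map_toPlace`: `d·E₂γ₂·d⁻¹ = s·ι(g)`, `g` given only through `tr g`, `det g` and up to `F^×`) and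
the torus-form hypotheses `hγ : ↑γ = !![a, b v; b, a + b u]` of ★ p846991 ∕ ★ (W′1).  Consumer: STUB B₂ of the P-2-ram skeleton (α₂) v0.2 (7cc84811), sub-type 2u.
HONEST LABEL: HC_CM is proved only modulo the cell's 2 remaining named inputs (hLiu418 24832, h413 24833) until rung 0 closes; nothing printed is asserted here — `2 × 2` linear
algebra over a field and set transport along the ★ projective action.

THE MATHEMATICS.  (§1, any field) A NON-SCALAR `2 × 2` matrix is conjugate to the COMPANION matrix of its characteristic polynomial: with a cyclic vector `e`
(`e₁` if `g₁₀ ≠ 0`, `e₂` if `g₀₁ ≠ 0`, `e₁ + e₂` if `g` is diagonal with distinct entries) and `P = [e | g e]`, `g P = P·(0, −det g; 1, tr g)` (Cayley–Hamilton); hence two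
non-scalar matrices with the same trace and determinant are conjugate (`exists_conj_eq_of_trace_eq_of_det_eq`).  (§2) If `tr g = t ≠ 0`, `det g = d`, `t² − 4d = ε₀ z²`
(`z ≠ 0`, `2 ≠ 0` in `F`): `g` is conjugate to `(t∕2)·(1, e ε₀; e, 1)`, `e := z∕t` — the regular representation of `(t∕2)(1 + eτ)`, `τ² = ε₀` (`u = 0`, `v = ε₀` in (W′1)'s
tokens).  (§3) Along the ★ projective action `glVertexAct` the fixed-vertex set is transported by conjugation (`{x | (hgh⁻¹)·x = x} = h·{x | g·x = x}`) and blind to scalars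
(★ `glVertexAct_scalar_mul`), so `#Fix(g) = #Fix(1 + eτ)`.  (§4) With `ε₀` a unit of NON-SQUARE residue the datum `(0, ε₀)` is INERT (`|c² − e²ε₀| < 1 ⇒ |c|, |e| < 1`), and for
`|e| = |ϖ|ⁿ` (automatic shape of a deep descended element: `|z| < |t|`) ★ p846991 gives **`(q − 1)·#{x | g·x = x} + 2 = (q + 1)·qⁿ`** — the VERTEX ball of radius `n`; in the
type-(2) application `N = 2n` is the EVEN discriminant depth (`|tr² − 4det|_w = exp(−2N)` on `L_w`, `e(w|v) = 2`).

* §1 `exists_cyclicFrame_of_not_isScalar`, `exists_conj_eq_companion_of_ne`, `exists_conj_eq_of_trace_eq_of_det_eq`.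
* §2 `trace_regRepOne_smul`, `det_regRepOne_smul`, `exists_conj_eq_smul_regRepOne`.
* §3 `setOf_glVertexAct_conj_eq_self_eq_image`, `ncard_setOf_glVertexAct_conj_eq_self`, `setOf_glVertexAct_smul_eq_self`.
* §4 `inertNorm_anisotropic_of_nonsquare_unit`, HEAD **`ncard_setOf_glVertexAct_eq_self_of_unramified_elliptic`**.

## References
* [LabesseLanglands1979] J.-P. Labesse, R. P. Langlands, *L-indistinguishability for SL(2)*, Canad. J. Math. 31 (1979), §2 p. 8.
* [Serre1980Trees] J.-P. Serre, *Trees* (1980), Ch. II §1.1 (balls in the `(q+1)`-regular tree), §1.3.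
* [Kottwitz1988] R. E. Kottwitz, *Tamagawa numbers*, Ann. of Math. 127 (1988), §2 (fixed points of an elliptic element form a ball).
-/

set_option autoImplicit false

noncomputable section

open scoped ValuativeRel Matrix MatrixGroups
open Matrix ValuativeRel

namespace Literature.NumberTheory.Automorphic.HermitianLatticeTree

open Literature.NumberTheory.Automorphic Literature.NumberTheory.LocalFields

section Algebra

variable {F : Type*} [Field F]

/-- **A CYCLIC FRAME**: a `2 × 2` matrix which is not scalar has an invertible `P` with `g P = P · (0, −det g; 1, tr g)` (`P = [e | g e]` for a cyclic vector `e`;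
Cayley–Hamilton in dimension two). [cite: Serre1980Trees, Ch. II §1.3] -/
theorem exists_cyclicFrame_of_not_isScalar (g : Matrix (Fin 2) (Fin 2) F) (hg : ¬ ∃ c : F, g = c • (1 : Matrix (Fin 2) (Fin 2) F)) :
    ∃ P : Matrix (Fin 2) (Fin 2) F, P.det ≠ 0 ∧ g * P = P * !![0, -g.det; 1, g.trace] := by
  have hge := Matrix.eta_fin_two g
  rw [Matrix.det_fin_two, Matrix.trace_fin_two]
  by_cases h10 : g 1 0 ≠ 0
  · refine ⟨!![1, g 0 0; 0, g 1 0], ?_, ?_⟩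
    · rw [Matrix.det_fin_two_of]; simpa using h10
    · rw [hge]; ext i j; fin_cases i <;> fin_cases j <;> simp [Matrix.mul_apply, Fin.sum_univ_two] <;> ring
  · rw [not_not] at h10
    by_cases h01 : g 0 1 ≠ 0
    · refine ⟨!![0, g 0 1; 1, g 1 1], ?_, ?_⟩
      · rw [Matrix.det_fin_two_of]; simpa using h01
      · rw [hge]; ext i j; fin_cases i <;> fin_cases j <;> simp [Matrix.mul_apply, Fin.sum_univ_two, h10] <;> ring
    · rw [not_not] at h01
      have hne : g 0 0 ≠ g 1 1 := by
        intro h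
        exact hg ⟨g 0 0, by rw [hge, h10, h01, h]; ext i j; fin_cases i <;> fin_cases j <;> simp⟩
      refine ⟨!![1, g 0 0; 1, g 1 1], ?_, ?_⟩
      · rw [Matrix.det_fin_two_of]; simpa [sub_eq_zero] using hne.symm
      · rw [hge]; ext i j; fin_cases i <;> fin_cases j <;> simp [Matrix.mul_apply, Fin.sum_univ_two, h10, h01] <;> ring

/-- **A non-scalar `g ∈ GL₂(F)` is conjugate to the companion matrix of its characteristic polynomial**: `∃ P ∈ GL₂(F)`, `P⁻¹ g P = (0, −det g; 1, tr g)` as matrices.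
[cite: Serre1980Trees, Ch. II §1.3] -/
theorem exists_conj_eq_companion_of_ne (g : GL (Fin 2) F) (hg : ¬ ∃ c : F, (g : Matrix (Fin 2) (Fin 2) F) = c • (1 : Matrix (Fin 2) (Fin 2) F)) :
    ∃ P : GL (Fin 2) F, ((P⁻¹ * g * P : GL (Fin 2) F) : Matrix (Fin 2) (Fin 2) F) = !![0, -(g : Matrix (Fin 2) (Fin 2) F).det; 1, (g : Matrix (Fin 2) (Fin 2) F).trace] := by
  obtain ⟨P, hP, hgP⟩ := exists_cyclicFrame_of_not_isScalar (g : Matrix (Fin 2) (Fin 2) F) hg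
  refine ⟨Matrix.GeneralLinearGroup.mk'' P (isUnit_iff_ne_zero.2 hP), ?_⟩
  rw [Units.val_mul, Units.val_mul, Matrix.coe_units_inv, Matrix.mul_assoc]
  show P⁻¹ * ((g : Matrix (Fin 2) (Fin 2) F) * P) = _
  rw [hgP, ← Matrix.mul_assoc, Matrix.nonsing_inv_mul _ (isUnit_iff_ne_zero.2 hP), Matrix.one_mul]

/-- **Two non-scalar elements of `GL₂(F)` with the same trace and determinant are conjugate**: `∃ h`, `h g h⁻¹ = g′` (both are conjugate to the common companion matrix).
[cite: Serre1980Trees, Ch. II §1.3] -/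
theorem exists_conj_eq_of_trace_eq_of_det_eq (g g' : GL (Fin 2) F)
    (hg : ¬ ∃ c : F, (g : Matrix (Fin 2) (Fin 2) F) = c • (1 : Matrix (Fin 2) (Fin 2) F))
    (hg' : ¬ ∃ c : F, (g' : Matrix (Fin 2) (Fin 2) F) = c • (1 : Matrix (Fin 2) (Fin 2) F))
    (htr : (g : Matrix (Fin 2) (Fin 2) F).trace = (g' : Matrix (Fin 2) (Fin 2) F).trace) (hdet : (g : Matrix (Fin 2) (Fin 2) F).det = (g' : Matrix (Fin 2) (Fin 2) F).det) :
    ∃ h : GL (Fin 2) F, h * g * h⁻¹ = g' := by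
  obtain ⟨P, hP⟩ := exists_conj_eq_companion_of_ne g hg
  obtain ⟨Q, hQ⟩ := exists_conj_eq_companion_of_ne g' hg'
  rw [htr, hdet, ← hQ] at hP
  have hPQ : P⁻¹ * g * P = Q⁻¹ * g' * Q := Units.ext hP
  refine ⟨Q * P⁻¹, ?_⟩
  calc Q * P⁻¹ * g * (Q * P⁻¹)⁻¹ = Q * (P⁻¹ * g * P) * Q⁻¹ := by group
    _ = g' := by rw [hPQ]; group

/-! ## §2 The torus form `(t∕2)·(1 + eτ)`, `τ² = ε₀`, `e = z∕t` -/

/-- Trace of `a·(1, eε₀; e, 1)` is `2a`. [cite: LabesseLanglands1979, §2 p. 7] -/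
theorem trace_smul_regRepOne (a e ε₀ : F) : (a • (!![1, e * ε₀; e, 1 + e * 0] : Matrix (Fin 2) (Fin 2) F)).trace = 2 * a := by
  rw [Matrix.trace_smul, Matrix.trace_fin_two_of]; simp; ring

/-- Determinant of `a·(1, eε₀; e, 1)` is `a²(1 − e²ε₀)`. [cite: LabesseLanglands1979, §2 p. 7] -/
theorem det_smul_regRepOne (a e ε₀ : F) : (a • (!![1, e * ε₀; e, 1 + e * 0] : Matrix (Fin 2) (Fin 2) F)).det = a ^ 2 * (1 - e ^ 2 * ε₀) := by
  rw [Matrix.det_smul, Matrix.det_fin_two_of, Fintype.card_fin]; ring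

/-- **CONJUGATION TO THE TORUS FORM.**  If `g ∈ GL₂(F)` has `tr g = t ≠ 0`, `det g = d` and `t² − 4d = ε₀·z²` with `z ≠ 0` (`2 ≠ 0` in `F`), then `g` is conjugate to the element
`γ` with `↑γ = (t∕2)·(1, eε₀; e, 1)`, `e = z∕t` — the regular representation of `(t∕2)(1 + eτ)`, `τ² = ε₀`: both are non-scalar (`z ≠ 0`) with trace `t` and determinant
`d = (t² − ε₀z²)∕4`. [cite: LabesseLanglands1979, §2 p. 8] [cite: Serre1980Trees, Ch. II §1.3] -/
theorem exists_conj_eq_smul_regRepOne (h2 : (2 : F) ≠ 0) {g : GL (Fin 2) F} {t d ε₀ z : F}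
    (htr : (g : Matrix (Fin 2) (Fin 2) F).trace = t) (hdet : (g : Matrix (Fin 2) (Fin 2) F).det = d) (ht : t ≠ 0) (hz : z ≠ 0) (hε₀ : ε₀ ≠ 0)
    (hD : t ^ 2 - 4 * d = ε₀ * z ^ 2) :
    ∃ (γ h : GL (Fin 2) F), (γ : Matrix (Fin 2) (Fin 2) F) = (t / 2) • !![1, (z / t) * ε₀; z / t, 1 + (z / t) * 0] ∧ h * g * h⁻¹ = γ := by
  have hdetγ : ((t / 2) • (!![1, (z / t) * ε₀; z / t, 1 + (z / t) * 0] : Matrix (Fin 2) (Fin 2) F)).det = d := by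
    have h4 : (4 : F) ≠ 0 := by rw [show (4 : F) = 2 * 2 by norm_num]; exact mul_ne_zero h2 h2
    rw [det_smul_regRepOne]
    have hq : (t / 2) ^ 2 * (1 - (z / t) ^ 2 * ε₀) = (t ^ 2 - ε₀ * z ^ 2) / 4 := by field_simp; ring
    rw [hq, ← hD]
    field_simp
    ring
  have hd0 : ((t / 2) • (!![1, (z / t) * ε₀; z / t, 1 + (z / t) * 0] : Matrix (Fin 2) (Fin 2) F)).det ≠ 0 := by
    rw [hdetγ, ← hdet]; exact (g.isUnit.map Matrix.detMonoidHom).ne_zero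
  set γ : GL (Fin 2) F := Matrix.GeneralLinearGroup.mk'' _ (isUnit_iff_ne_zero.2 hd0) with hγ
  have hγcoe : (γ : Matrix (Fin 2) (Fin 2) F) = (t / 2) • !![1, (z / t) * ε₀; z / t, 1 + (z / t) * 0] := rfl
  -- neither `g` nor `γ` is scalar
  have hγns : ¬ ∃ c : F, (γ : Matrix (Fin 2) (Fin 2) F) = c • (1 : Matrix (Fin 2) (Fin 2) F) := by
    rintro ⟨c, hc⟩
    have h10 := congrArg (fun M : Matrix (Fin 2) (Fin 2) F => M 1 0) hc
    simp [hγcoe, ht, hz, h2] at h10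
  have hgns : ¬ ∃ c : F, (g : Matrix (Fin 2) (Fin 2) F) = c • (1 : Matrix (Fin 2) (Fin 2) F) := by
    rintro ⟨c, hc⟩
    have htc : t = 2 * c := by rw [← htr, hc, Matrix.trace_smul, Matrix.trace_one, Fintype.card_fin]; simp; ring
    have hdc : d = c ^ 2 := by rw [← hdet, hc, Matrix.det_smul, Matrix.det_one, Fintype.card_fin, mul_one]
    have : ε₀ * z ^ 2 = 0 := by rw [← hD, htc, hdc]; ring
    rcases mul_eq_zero.1 this with h | h
    · exact hε₀ h
    · exact hz (pow_eq_zero_iff two_ne_zero |>.1 h)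
  obtain ⟨h, hh⟩ := exists_conj_eq_of_trace_eq_of_det_eq g γ hgns hγns (by rw [htr, hγcoe, trace_smul_regRepOne]; field_simp) (by rw [hdet, hγcoe, hdetγ])
  exact ⟨γ, h, hγcoe, hh⟩

end Algebra

/-! ## §3 Transport of the fixed-vertex set under conjugation and scalars -/

section Transport

variable {F : Type*} [Field F] [ValuativeRel F] {ϖ : F} (hϖ : IsUniformizingElement ϖ) [IsDiscreteValuationRing 𝒪[F]]

include hϖ in
/-- **`Fix(h g h⁻¹) = h · Fix(g)`** on the vertices of the tree of `SL₂(F)`. [cite: Serre1980Trees, Ch. II §1.3] -/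
theorem setOf_glVertexAct_conj_eq_self_eq_image (g h : GL (Fin 2) F) :
    {x : {M : Submodule 𝒪[F] (Fin 2 → F) // IsSpecialLattice (RingHom.id F) ϖ !![(0 : F), 1; -1, 0] M} | glVertexAct hϖ (h * g * h⁻¹) x = x} =
      glVertexAct hϖ h '' {x | glVertexAct hϖ g x = x} := by
  ext x
  simp only [Set.mem_setOf_eq, Set.mem_image]
  constructor
  · intro hx
    refine ⟨glVertexAct hϖ h⁻¹ x, ?_, ?_⟩
    · have h1 := congrArg (glVertexAct hϖ h⁻¹) hx
      rw [← glVertexAct_mul, ← mul_assoc, ← mul_assoc, inv_mul_cancel, one_mul, glVertexAct_mul] at h1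
      exact h1
    · rw [← glVertexAct_mul, mul_inv_cancel, glVertexAct_one]
  · rintro ⟨y, hy, rfl⟩
    rw [glVertexAct_mul, glVertexAct_mul, ← glVertexAct_mul hϖ h⁻¹, inv_mul_cancel, glVertexAct_one, hy]

include hϖ in
/-- **`#Fix(h g h⁻¹) = #Fix(g)`** (conjugation is a bijection of the vertex set). [cite: Serre1980Trees, Ch. II §1.3] -/
theorem ncard_setOf_glVertexAct_conj_eq_self (g h : GL (Fin 2) F) :
    {x : {M : Submodule 𝒪[F] (Fin 2 → F) // IsSpecialLattice (RingHom.id F) ϖ !![(0 : F), 1; -1, 0] M} | glVertexAct hϖ (h * g * h⁻¹) x = x}.ncard =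
      {x : {M : Submodule 𝒪[F] (Fin 2 → F) // IsSpecialLattice (RingHom.id F) ϖ !![(0 : F), 1; -1, 0] M} | glVertexAct hϖ g x = x}.ncard := by
  rw [setOf_glVertexAct_conj_eq_self_eq_image hϖ g h, Set.ncard_image_of_injective _ (glVertexAct_injective hϖ h)]

include hϖ in
/-- **Scalars do not move vertices**: `Fix(c · g) = Fix(g)` for `c ∈ F^×` (★ `glVertexAct_scalar_mul`). [cite: Serre1980Trees, Ch. II §1.3] -/
theorem setOf_glVertexAct_smul_eq_self {g γ : GL (Fin 2) F} {c : F} (hc : c ≠ 0) (hγ : (γ : Matrix (Fin 2) (Fin 2) F) = c • (g : Matrix (Fin 2) (Fin 2) F)) :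
    {x : {M : Submodule 𝒪[F] (Fin 2 → F) // IsSpecialLattice (RingHom.id F) ϖ !![(0 : F), 1; -1, 0] M} | glVertexAct hϖ γ x = x} = {x | glVertexAct hϖ g x = x} := by
  have hγe : γ = (Units.mk0 c hc).map ((Matrix.scalar (Fin 2) : F →+* Matrix (Fin 2) (Fin 2) F) : F →* Matrix (Fin 2) (Fin 2) F) * g := by
    apply Units.ext
    rw [Units.val_mul, Units.coe_map, MonoidHom.coe_coe, Matrix.scalar_apply, Units.val_mk0, hγ, ← Matrix.smul_one_eq_diagonal, Matrix.smul_mul, Matrix.one_mul]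
  ext x
  simp only [Set.mem_setOf_eq]
  rw [hγe, glVertexAct_scalar_mul]

end Transport

/-! ## §4 The vertex ball of an unramified-elliptic element -/

section Ball

variable {F : Type*} [Field F] [ValuativeRel F] {ϖ : F} (hϖ : IsUniformizingElement ϖ) [IsDiscreteValuationRing 𝒪[F]]

omit [IsDiscreteValuationRing 𝒪[F]] in
/-- **The datum `(u, v) = (0, ε₀)` is INERT when `ε₀` is a unit of non-square residue**: `|c² + c·e·0 − e²ε₀| < 1` with `c e ∈ 𝒪` forces `|c| < 1` and `|e| < 1`
(`c̄² = ē²ε̄₀` in `𝓀`: `ē ≠ 0` would make `ε̄₀` a square, and `ē = 0` gives `c̄ = 0`).  Hypothesis spelling of ★ `QuadraticUnramifiedOrderUnitIndex` (`∀ b, b² − ε₀ ∈ 𝒪^×`) in valuation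
currency: `hns : ∀ b ∈ 𝒪, |b² − ε₀| = 1`. [cite: LabesseLanglands1979, §2 p. 8] [cite: Serre1980Trees, Ch. II §1.1] -/
theorem inertNorm_anisotropic_of_nonsquare_unit {ε₀ : F} (hns : ∀ b : F, b ∈ 𝒪[F] → valuation F (b ^ 2 - ε₀) = 1) :
    ∀ c e : F, c ∈ 𝒪[F] → e ∈ 𝒪[F] → valuation F (c ^ 2 + c * e * 0 - e ^ 2 * ε₀) < 1 → valuation F c < 1 ∧ valuation F e < 1 := by
  intro c e hc he hlt
  rw [mul_zero, add_zero] at hlt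
  have hc1 : valuation F c ≤ 1 := (Valuation.mem_integer_iff _ _).1 hc
  have he1 : valuation F e ≤ 1 := (Valuation.mem_integer_iff _ _).1 he
  have hε1 : valuation F ε₀ = 1 := by
    have h := hns 0 (zero_mem _)
    rwa [zero_pow two_ne_zero, zero_sub, Valuation.map_neg] at h
  by_cases hev : valuation F e < 1
  · -- then `|c²| < 1`
    refine ⟨?_, hev⟩
    have h3 : valuation F (e ^ 2 * ε₀) < 1 := by
      rw [map_mul, hε1, mul_one, map_pow, pow_two]; exact mul_lt_one_of_nonneg_of_lt_one_left zero_le hev he1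
    have hc2 : valuation F (c ^ 2) < 1 := by
      have : c ^ 2 = (c ^ 2 - e ^ 2 * ε₀) + e ^ 2 * ε₀ := by ring
      rw [this]; exact lt_of_le_of_lt (Valuation.map_add _ _ _) (max_lt hlt h3)
    by_contra hcn
    have hcv : valuation F c = 1 := le_antisymm hc1 (not_lt.1 hcn)
    rw [map_pow, hcv, one_pow] at hc2
    exact lt_irrefl _ hc2
  · -- `e` a unit: `(c e⁻¹)² − ε₀` would be a non-unit
    exfalso
    have hev1 : valuation F e = 1 := le_antisymm he1 (not_lt.1 hev)
    have he0 : e ≠ 0 := fun h => by rw [h, map_zero] at hev1; exact zero_ne_one hev1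
    have hbO : c * e⁻¹ ∈ 𝒪[F] := by rw [Valuation.mem_integer_iff, map_mul, map_inv₀, hev1, inv_one, mul_one]; exact hc1
    have hkey : (c * e⁻¹) ^ 2 - ε₀ = (c ^ 2 - e ^ 2 * ε₀) * (e ^ 2)⁻¹ := by field_simp
    have h := hns _ hbO
    rw [hkey, map_mul, map_inv₀, map_pow, hev1, one_pow, inv_one, mul_one] at h
    rw [h] at hlt
    exact lt_irrefl _ hlt

include hϖ in
/-- **THE VERTEX BALL OF AN UNRAMIFIED-ELLIPTIC ELEMENT** (HEAD).  Let `ε₀ ∈ 𝒪` have non-square residue (`hns`), `(2 : F) ≠ 0`, and let `g ∈ GL₂(F)` have `tr g = t ≠ 0`,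
`det g = d`, `t² − 4d = ε₀·z²` with `z ≠ 0` and `|z · t⁻¹| = |ϖ|ⁿ` (for `n ≥ 1` this is the DEEP unramified-elliptic shape of the descended element of a type-(2) `γ_H` of even
discriminant depth `2n` at a tame-ramified place).  Then the set of vertices of the tree of `SL₂(F)` fixed by `g` is finite and
**`(q − 1)·#{x | g·x = x} + 2 = (q + 1)·qⁿ`** (`q = #𝓀_F`): `g ~ (t∕2)(1 + eτ)`, `e = z∕t`, `τ² = ε₀` (§2), fixed sets transport (§3), and ★ p846991
`ncard_setOf_glVertexAct_torus_eq_self_of_inert` for the unit `1 + eτ` of the inert order.  The base vertex `v₀ = latt 1` is a binder as in (W′1).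
[cite: LabesseLanglands1979, §2 p. 8] [cite: Serre1980Trees, Ch. II §1.1] [cite: Kottwitz1988, §2] -/
theorem ncard_setOf_glVertexAct_eq_self_of_unramified_elliptic [Finite (IsLocalRing.ResidueField 𝒪[F])] (h2 : (2 : F) ≠ 0)
    {ε₀ : F} (hε₀ : ε₀ ∈ 𝒪[F]) (hns : ∀ b : F, b ∈ 𝒪[F] → valuation F (b ^ 2 - ε₀) = 1)
    {g : GL (Fin 2) F} {t d z : F} (htr : (g : Matrix (Fin 2) (Fin 2) F).trace = t) (hdet : (g : Matrix (Fin 2) (Fin 2) F).det = d) (ht : t ≠ 0) (hz : z ≠ 0)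
    (hD : t ^ 2 - 4 * d = ε₀ * z ^ 2) {n : ℕ} (hn : valuation F (z * t⁻¹) = valuation F ϖ ^ n)
    (v₀ : {M : Submodule 𝒪[F] (Fin 2 → F) // IsSpecialLattice (RingHom.id F) ϖ !![(0 : F), 1; -1, 0] M}) (hv₀ : v₀.1 = latt (1 : Matrix (Fin 2) (Fin 2) F)) :
    (Nat.card (IsLocalRing.ResidueField 𝒪[F]) - 1) * {x : {M : Submodule 𝒪[F] (Fin 2 → F) // IsSpecialLattice (RingHom.id F) ϖ !![(0 : F), 1; -1, 0] M} | glVertexAct hϖ g x = x}.ncard + 2 =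
      (Nat.card (IsLocalRing.ResidueField 𝒪[F]) + 1) * Nat.card (IsLocalRing.ResidueField 𝒪[F]) ^ n := by
  have h0 := hϖ.ne_zero
  have hε1 : valuation F ε₀ = 1 := by
    have h := hns 0 (zero_mem _)
    rwa [zero_pow two_ne_zero, zero_sub, Valuation.map_neg] at h
  have hε0 : ε₀ ≠ 0 := fun h => by rw [h, map_zero] at hε1; exact zero_ne_one hε1
  have hanis := inertNorm_anisotropic_of_nonsquare_unit hns
  have hE := integral_of_valuation_inertNorm_le_one hanis
  -- the torus form and the conjugation
  obtain ⟨γ, h, hγ, hconj⟩ := exists_conj_eq_smul_regRepOne h2 htr hdet ht hz hε0 hD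
  set e : F := z / t with he
  have heO : e ∈ 𝒪[F] := by
    rw [Valuation.mem_integer_iff, he, div_eq_mul_inv, hn]; exact pow_le_one₀ zero_le hϖ.valuation_le_one
  have hev : valuation F e = valuation F ϖ ^ n := by rw [he, div_eq_mul_inv, hn]
  -- the unit `1 + eτ` of the inert order as an element of `GL₂(F)`
  have hNdet : valuation F ((1 : F) ^ 2 + 1 * e * 0 - e ^ 2 * ε₀) = 1 := valuation_inertNorm_eq_one_of_or (zero_mem _) hε₀ hanis (one_mem _) heO (Or.inl (map_one _))
  have hdet0 : (!![(1 : F), e * ε₀; e, 1 + e * 0]).det ≠ 0 := by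
    rw [QuadraticRegularRep.det_regRep]; intro h'; rw [h', map_zero] at hNdet; exact zero_ne_one hNdet
  set γ₁ : GL (Fin 2) F := Matrix.GeneralLinearGroup.mk'' _ (isUnit_iff_ne_zero.2 hdet0) with hγ₁
  have hγ₁coe : (γ₁ : Matrix (Fin 2) (Fin 2) F) = !![(1 : F), e * ε₀; e, 1 + e * 0] := rfl
  have hγ₁det : valuation F (γ₁ : Matrix (Fin 2) (Fin 2) F).det = 1 := by rw [hγ₁coe, QuadraticRegularRep.det_regRep]; exact hNdet
  have hγsmul : (γ : Matrix (Fin 2) (Fin 2) F) = (t / 2) • (γ₁ : Matrix (Fin 2) (Fin 2) F) := by rw [hγ, hγ₁coe]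
  have ht2 : t / 2 ≠ 0 := div_ne_zero ht h2
  -- transport: `#Fix(g) = #Fix(γ) = #Fix(γ₁)`
  have hfix : {x : {M : Submodule 𝒪[F] (Fin 2 → F) // IsSpecialLattice (RingHom.id F) ϖ !![(0 : F), 1; -1, 0] M} | glVertexAct hϖ g x = x}.ncard =
      {x | glVertexAct hϖ γ₁ x = x}.ncard := by
    rw [← ncard_setOf_glVertexAct_conj_eq_self hϖ g h, hconj, setOf_glVertexAct_smul_eq_self hϖ ht2 hγsmul]
  rw [hfix]
  -- the shell machinery of (W′1) for the datum `(0, ε₀)`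
  have hdetτ : (!![(0 : F), ε₀; 1, 0]).det ≠ 0 := by rw [Matrix.det_fin_two_of]; simpa using hε0
  set γτ : GL (Fin 2) F := Matrix.GeneralLinearGroup.mk'' _ (isUnit_iff_ne_zero.2 hdetτ) with hγτ
  have hγτcoe : (γτ : Matrix (Fin 2) (Fin 2) F) = !![(0 : F), ε₀; 1, 0] := rfl
  obtain ⟨r, hr⟩ := exists_shellRep_fn (F := F) h0
  obtain ⟨dd, hd, hd'⟩ := exists_shellIndex hϖ (zero_mem _) hε₀ hE v₀ hv₀
  exact ncard_setOf_glVertexAct_torus_eq_self_of_inert hϖ (zero_mem _) hε₀ hanis (one_mem _) heO hev hγ₁coe hγ₁det hγτcoe hr v₀ hv₀ hd hd'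

end Ball

end Literature.NumberTheory.Automorphic.HermitianLatticeTree

end
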